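import Summits.NavierStokesRegularity.FluidComputer.PalasekTowerRegisterGlobalReball
import Summits.NavierStokesRegularity.FluidComputer.PalasekTowerRegisterGlobalFloorsAt
import Summits.NavierStokesRegularity.FluidComputer.PalasekTowerRegisterGlobalRecentre

/-!
# REGISTER v2.3′: the BALL LEVER on each readout property `ReadoutAt k P` — the three floor stubs of the first
# rung (`SpeedFloorAt 1`, `StrainFloorAt 1`, `CoreFloorAt 1`) are asked inside EVERY admissible ball

Cell `ns-blowup`, seat `ns-blowup-fc-prover-3` (g4; D-0074 GROUP C/E «BRIDGE SUPPORT»; bears_on LADDER-NS N1,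
route `PalasekTowerBreakdown`, child crux stmt-NavierStokesRegularity-19249 `HeredityAtOne`, registered skeleton v3
`Cruxes/HeredityAtOne/Lines/birth.lean` 2d6b5976e149bfa1: stubs `stub_apriori_ceiling_at_one : AprioriCeilingAt 1`,
`stub_speed_floor_at_one : SpeedFloorAt 1`, `stub_strain_floor_at_one : StrainFloorAt 1`,
`stub_core_floor_at_one : CoreFloorAt 1` — supported, NOT closed or claimed). Companion of
`PalasekTowerRegisterGlobalReball.lean` (this seat, p457497: `Schedule.reball`, `Schedule.ConfinedTo`,
`Schedule.ReadsIn`, `Stage.reball`, the lever on `HeredityAt k` / `ReadoutFloorsAt k`) and of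
`PalasekTowerRegisterGlobalFloorsAt.lean` (ns-palasek-19249-p2, p452330: the generic readout property
`ReadoutAt k P` and the three floors). LABEL: E–C typing (KERNEL: transport of `ReadoutAt k P` along re-balling and
its instances; no named fact, no `sorry`). WHAT THIS IS NOT: not Navier–Stokes evidence — no stage or flow is
constructed; the floor stubs appear only as hypotheses, or negated in the conclusion of TEMPLATES whose premise is
ONE EXHIBITED registered stage (none is known: vacuity stands).

## What is proved

* §1 `ReadoutAt.reball`: a readout property `ReadoutAt k P` holds, for every admissible radius `r` (confining
  `(u₀, f)`, reading the levels `j ≤ k` of the stage), with the RE-BALLED schedule in the predicate slot: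
  `P (S.reball r) (u (τ (k+1)))` for every tame continuation `(u, p)` of the stage — because `ReadoutAt k P`
  quantifies over all pinned rigid quiet schedules and `S.reball r` is one, with the same stages and the same
  continuations.
* §2 the three floors of the first rung's lower half, re-balled: under `SpeedFloorAt k` (resp. `StrainFloorAt k`,
  `CoreFloorAt k`) every tame continuation of every registered level-`k` stage shows speed `≥ c₁ Y_{k+1}` (resp.
  strain `≥ c₁ A_{k+1}`, an `N_{k+1}`-core loop) at `τ (k+1)` inside EVERY ball `B̄(0, r)` that confines `(u₀, f)`
  and reads the levels `j ≤ k` — the predicate's `‖x‖ ≤ S.radius` becomes `‖x‖ ≤ r`; TEMPLATES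
  `not_speedFloorAt_of_continuation_speed_lt` (ONE registered stage, ONE admissible `r`, ONE tame continuation with
  speed `< c₁ Y_{k+1}` throughout `B̄(0, r)` at `τ (k+1)` refutes `SpeedFloorAt k` — at `k = 1` the registered stub
  `stub_speed_floor_at_one`), `not_strainFloorAt_of_continuation_strain_lt`, `not_coreFloorAt_of_no_core_in`.

Reading: the three v3 floor stubs each inherit the UNINTENDED GEOMETRIC CONJUNCT of the `∀`-form (the readout
point must lie in the SMALLEST ball that confines the design and reads the earlier levels, although a structure
at the floor speed `Y₁` covers `≈ 68/N₁` during the rigid window `[τ₁, τ₂]`); a registered stage violating it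
refutes the stub by bookkeeping, not by mechanism (MISSTATEMENT class; repair: a level-indexed or conclusion-side
radius). The upper stub `AprioriCeilingAt 1` is radius-free and untouched.

(g4 append) §3 THE SAME FOR BALLS OF ANY CENTRE (`PalasekTowerRegisterGlobalRecentre.lean`: re-centring `S.translate c`,
`Schedule.ReadsInBall`): `ReadoutAt.translate_reball` (a readout property holds, for every tame continuation, with the
re-centred re-balled schedule in the predicate slot and the re-centred slice), `SpeedFloorAt.speed_mem_ball` /
`StrainFloorAt.strain_mem_ball` (speed / strain floor of level `k + 1` inside EVERY ball `B̄(c, r)` of any centre that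
confines `(u₀, f)` and reads the levels `≤ k`), templates `not_speedFloorAt_of_continuation_speed_lt_ball` /
`not_strainFloorAt_of_continuation_strain_lt_ball`, and `ReadoutFloorsAt.readsInBall` / `readsInBall_of_floors`.

References: S. Palasek, arXiv:2605.13827 §3.1, §4 [cite: Palasek2026ElementaryModel, §4].
-/

noncomputable section

namespace Summit.NavierStokesRegularity.FluidComputer.PalasekTowerClayBridge

open Set MeasureTheory Filter Topology Function Real
open scoped ENNReal ContDiff NNReal
open Literature.Analysis.FluidPDE

/-! ## §1 Transport of a readout property along re-balling -/

section Transport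

open Schedule

variable {k : ℕ} {P : Schedule TowerRates.wide → (EuclideanSpace ℝ (Fin 3) → EuclideanSpace ℝ (Fin 3)) → Prop}
  {S : Schedule TowerRates.wide}

/-- **A readout property re-balled.** If `ReadoutAt k P` holds, then for every pinned rigid quiet wide schedule
`S`, every registered level-`k` stage `s`, every radius `r` such that `B̄(0, r)` confines `(u₀, f)` and reads the
levels `j ≤ k` of `s`, and every tame continuation `(u, p)` of `s` to `τ (k+1)` (classical, agreeing with `s` on
`[0, τ k]`, finite energy, inside the ceiling `c₂ Y_{k+1}`), the property holds WITH THE RE-BALLED SCHEDULE: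
`P (S.reball r) (u (τ (k+1)))` (apply the hypothesis to `S.reball r` and `s.reball r`).
[cite: Palasek2026ElementaryModel, §4] -/
theorem ReadoutAt.reball (h : ReadoutAt k P) (hP : S.Pins 8 (6 / 5)) (hR : S.Rigid) (hQ : S.Quiet)
    (s : Stage 1 TowerRates.wide S (Margins.routeG TowerRates.wide) k) {r : ℝ} (hc : S.ConfinedTo r)
    (hs : ∀ j, j ≤ k → S.ReadsIn j r (s.u (S.τ j)))
    {u : ℝ → EuclideanSpace ℝ (Fin 3) → EuclideanSpace ℝ (Fin 3)} {p : ℝ → EuclideanSpace ℝ (Fin 3) → ℝ}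
    (hcl : IsClassicalNSSolutionOn (Icc 0 (S.τ (k + 1))) 1 S.f u p)
    (hagree : ∀ t ∈ Icc 0 (S.τ k), u t = s.u t ∧ p t = s.p t)
    (henergy : ∃ C : ℝ≥0∞, C < ⊤ ∧ ∀ t ∈ Icc 0 (S.τ (k + 1)), ∫⁻ x, ‖u t x‖ₑ ^ 2 ≤ C)
    (hceil : ∀ t ∈ Icc 0 (S.τ (k + 1)), ∀ x, ‖u t x‖ ≤ S.c₂ * TowerRates.wide.Y (k + 1)) :
    P (S.reball r) (u (S.τ (k + 1))) :=
  h (S.reball r) (hP.reball hc) (hR.reball r) (hQ.reball r) (s.reball r hs) u p hcl hagree henergy hceil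

end Transport

/-! ## §2 The three floors of the first rung's lower half, re-balled, and their templates -/

section Floors

open Schedule

variable {k : ℕ} {S : Schedule TowerRates.wide}

/-- **The speed floor re-balled.** Under `SpeedFloorAt k`, every tame continuation of every registered level-`k`
stage shows speed `≥ c₁ Y_{k+1}` at `τ (k+1)` inside EVERY ball `B̄(0, r)` that confines `(u₀, f)` and reads the
levels `j ≤ k` of the stage (no comparison of `r` with `S.radius` needed). [cite: Palasek2026ElementaryModel, §4] -/
theorem SpeedFloorAt.speed_mem_reball (h : SpeedFloorAt k) (hP : S.Pins 8 (6 / 5)) (hR : S.Rigid)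
    (hQ : S.Quiet) (s : Stage 1 TowerRates.wide S (Margins.routeG TowerRates.wide) k) {r : ℝ}
    (hc : S.ConfinedTo r) (hs : ∀ j, j ≤ k → S.ReadsIn j r (s.u (S.τ j)))
    {u : ℝ → EuclideanSpace ℝ (Fin 3) → EuclideanSpace ℝ (Fin 3)} {p : ℝ → EuclideanSpace ℝ (Fin 3) → ℝ}
    (hcl : IsClassicalNSSolutionOn (Icc 0 (S.τ (k + 1))) 1 S.f u p)
    (hagree : ∀ t ∈ Icc 0 (S.τ k), u t = s.u t ∧ p t = s.p t)
    (henergy : ∃ C : ℝ≥0∞, C < ⊤ ∧ ∀ t ∈ Icc 0 (S.τ (k + 1)), ∫⁻ x, ‖u t x‖ₑ ^ 2 ≤ C)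
    (hceil : ∀ t ∈ Icc 0 (S.τ (k + 1)), ∀ x, ‖u t x‖ ≤ S.c₂ * TowerRates.wide.Y (k + 1)) :
    ∃ x, ‖x‖ ≤ r ∧ S.c₁ * TowerRates.wide.Y (k + 1) ≤ ‖u (S.τ (k + 1)) x‖ :=
  ReadoutAt.reball h hP hR hQ s hc hs hcl hagree henergy hceil

/-- **TEMPLATE for `SpeedFloorAt k`** (at `k = 1`: the registered stub `stub_speed_floor_at_one` of item 19249).
ONE pinned rigid quiet wide design, ONE registered level-`k` stage `s`, ONE radius `r` such that `B̄(0, r)`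
confines `(u₀, f)` and reads the levels `j ≤ k` of `s`, ONE tame continuation `(u, p)` of `s` to `τ (k+1)` whose
speed at `τ (k+1)` stays `< c₁ Y_{k+1}` throughout `B̄(0, r)` — refutes `SpeedFloorAt k`. (Vacuity warning: no
registered stage is known.) [cite: Palasek2026ElementaryModel, §4] -/
theorem not_speedFloorAt_of_continuation_speed_lt (hP : S.Pins 8 (6 / 5)) (hR : S.Rigid) (hQ : S.Quiet)
    (s : Stage 1 TowerRates.wide S (Margins.routeG TowerRates.wide) k) {r : ℝ}
    (hc : S.ConfinedTo r) (hs : ∀ j, j ≤ k → S.ReadsIn j r (s.u (S.τ j)))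
    {u : ℝ → EuclideanSpace ℝ (Fin 3) → EuclideanSpace ℝ (Fin 3)} {p : ℝ → EuclideanSpace ℝ (Fin 3) → ℝ}
    (hcl : IsClassicalNSSolutionOn (Icc 0 (S.τ (k + 1))) 1 S.f u p)
    (hagree : ∀ t ∈ Icc 0 (S.τ k), u t = s.u t ∧ p t = s.p t)
    (henergy : ∃ C : ℝ≥0∞, C < ⊤ ∧ ∀ t ∈ Icc 0 (S.τ (k + 1)), ∫⁻ x, ‖u t x‖ₑ ^ 2 ≤ C)
    (hceil : ∀ t ∈ Icc 0 (S.τ (k + 1)), ∀ x, ‖u t x‖ ≤ S.c₂ * TowerRates.wide.Y (k + 1))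
    (hesc : ∀ x, ‖x‖ ≤ r → ‖u (S.τ (k + 1)) x‖ < S.c₁ * TowerRates.wide.Y (k + 1)) :
    ¬ SpeedFloorAt k := fun h => by
  obtain ⟨x, hx, hge⟩ := h.speed_mem_reball hP hR hQ s hc hs hcl hagree henergy hceil
  exact absurd (hesc x hx) (not_lt.2 hge)

/-- **The strain floor re-balled.** Under `StrainFloorAt k`, every tame continuation of every registered
level-`k` stage shows a velocity gradient of operator norm `≥ c₁ A_{k+1}` at `τ (k+1)` inside EVERY ball
`B̄(0, r)` that confines `(u₀, f)` and reads the levels `j ≤ k` of the stage. [cite: Palasek2026ElementaryModel, §4] -/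
theorem StrainFloorAt.strain_mem_reball (h : StrainFloorAt k) (hP : S.Pins 8 (6 / 5)) (hR : S.Rigid)
    (hQ : S.Quiet) (s : Stage 1 TowerRates.wide S (Margins.routeG TowerRates.wide) k) {r : ℝ}
    (hc : S.ConfinedTo r) (hs : ∀ j, j ≤ k → S.ReadsIn j r (s.u (S.τ j)))
    {u : ℝ → EuclideanSpace ℝ (Fin 3) → EuclideanSpace ℝ (Fin 3)} {p : ℝ → EuclideanSpace ℝ (Fin 3) → ℝ}
    (hcl : IsClassicalNSSolutionOn (Icc 0 (S.τ (k + 1))) 1 S.f u p)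
    (hagree : ∀ t ∈ Icc 0 (S.τ k), u t = s.u t ∧ p t = s.p t)
    (henergy : ∃ C : ℝ≥0∞, C < ⊤ ∧ ∀ t ∈ Icc 0 (S.τ (k + 1)), ∫⁻ x, ‖u t x‖ₑ ^ 2 ≤ C)
    (hceil : ∀ t ∈ Icc 0 (S.τ (k + 1)), ∀ x, ‖u t x‖ ≤ S.c₂ * TowerRates.wide.Y (k + 1)) :
    ∃ x, ‖x‖ ≤ r ∧ S.c₁ * TowerRates.wide.A (k + 1) ≤ ‖fderiv ℝ (u (S.τ (k + 1))) x‖ :=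
  ReadoutAt.reball h hP hR hQ s hc hs hcl hagree henergy hceil

/-- **TEMPLATE for `StrainFloorAt k`** (at `k = 1`: the registered stub `stub_strain_floor_at_one`): ONE registered
level-`k` stage, ONE admissible radius `r`, ONE tame continuation whose velocity gradient at `τ (k+1)` has operator
norm `< c₁ A_{k+1}` throughout `B̄(0, r)` — refutes `StrainFloorAt k`. [cite: Palasek2026ElementaryModel, §4] -/
theorem not_strainFloorAt_of_continuation_strain_lt (hP : S.Pins 8 (6 / 5)) (hR : S.Rigid) (hQ : S.Quiet)
    (s : Stage 1 TowerRates.wide S (Margins.routeG TowerRates.wide) k) {r : ℝ}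
    (hc : S.ConfinedTo r) (hs : ∀ j, j ≤ k → S.ReadsIn j r (s.u (S.τ j)))
    {u : ℝ → EuclideanSpace ℝ (Fin 3) → EuclideanSpace ℝ (Fin 3)} {p : ℝ → EuclideanSpace ℝ (Fin 3) → ℝ}
    (hcl : IsClassicalNSSolutionOn (Icc 0 (S.τ (k + 1))) 1 S.f u p)
    (hagree : ∀ t ∈ Icc 0 (S.τ k), u t = s.u t ∧ p t = s.p t)
    (henergy : ∃ C : ℝ≥0∞, C < ⊤ ∧ ∀ t ∈ Icc 0 (S.τ (k + 1)), ∫⁻ x, ‖u t x‖ₑ ^ 2 ≤ C)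
    (hceil : ∀ t ∈ Icc 0 (S.τ (k + 1)), ∀ x, ‖u t x‖ ≤ S.c₂ * TowerRates.wide.Y (k + 1))
    (hesc : ∀ x, ‖x‖ ≤ r → ‖fderiv ℝ (u (S.τ (k + 1))) x‖ < S.c₁ * TowerRates.wide.A (k + 1)) :
    ¬ StrainFloorAt k := fun h => by
  obtain ⟨x, hx, hge⟩ := h.strain_mem_reball hP hR hQ s hc hs hcl hagree henergy hceil
  exact absurd (hesc x hx) (not_lt.2 hge)

/-- **The core floor re-balled.** Under `CoreFloorAt k`, every tame continuation of every registered level-`k`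
stage carries at `τ (k+1)` an `N_{k+1}`-core loop (closed `C¹` loop of speed `≤ 8π/N_{k+1}` inside a ball of
radius `1/N_{k+1}`, circulation `≥ c₁ N_{k+1}^{β-2}`) whose core ball is centred inside EVERY ball `B̄(0, r)`
that confines `(u₀, f)` and reads the levels `j ≤ k` of the stage. [cite: Palasek2026ElementaryModel, §3.1] -/
theorem CoreFloorAt.core_mem_reball (h : CoreFloorAt k) (hP : S.Pins 8 (6 / 5)) (hR : S.Rigid)
    (hQ : S.Quiet) (s : Stage 1 TowerRates.wide S (Margins.routeG TowerRates.wide) k) {r : ℝ}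
    (hc : S.ConfinedTo r) (hs : ∀ j, j ≤ k → S.ReadsIn j r (s.u (S.τ j)))
    {u : ℝ → EuclideanSpace ℝ (Fin 3) → EuclideanSpace ℝ (Fin 3)} {p : ℝ → EuclideanSpace ℝ (Fin 3) → ℝ}
    (hcl : IsClassicalNSSolutionOn (Icc 0 (S.τ (k + 1))) 1 S.f u p)
    (hagree : ∀ t ∈ Icc 0 (S.τ k), u t = s.u t ∧ p t = s.p t)
    (henergy : ∃ C : ℝ≥0∞, C < ⊤ ∧ ∀ t ∈ Icc 0 (S.τ (k + 1)), ∫⁻ x, ‖u t x‖ₑ ^ 2 ≤ C)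
    (hceil : ∀ t ∈ Icc 0 (S.τ (k + 1)), ∀ x, ‖u t x‖ ≤ S.c₂ * TowerRates.wide.Y (k + 1)) :
    ∃ (x : EuclideanSpace ℝ (Fin 3)) (γ : ℝ → EuclideanSpace ℝ (Fin 3)),
      ‖x‖ ≤ r ∧ ContDiff ℝ 1 γ ∧ γ 0 = γ 1 ∧
      (∀ σ ∈ Icc (0 : ℝ) 1, γ σ ∈ Metric.closedBall x (1 / TowerRates.wide.N (k + 1))) ∧
      (∀ σ ∈ Icc (0 : ℝ) 1, ‖deriv γ σ‖ ≤ 8 * π / TowerRates.wide.N (k + 1)) ∧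
      S.c₁ * TowerRates.wide.N (k + 1) ^ (TowerRates.wide.β - 2) ≤ circulation (u (S.τ (k + 1))) γ :=
  ReadoutAt.reball h hP hR hQ s hc hs hcl hagree henergy hceil

/-- **TEMPLATE for `CoreFloorAt k`** (at `k = 1`: the registered stub `stub_core_floor_at_one`): ONE registered
level-`k` stage, ONE admissible radius `r`, ONE tame continuation carrying at `τ (k+1)` NO `N_{k+1}`-core loop
centred in `B̄(0, r)` — refutes `CoreFloorAt k`. [cite: Palasek2026ElementaryModel, §3.1] -/
theorem not_coreFloorAt_of_no_core_in (hP : S.Pins 8 (6 / 5)) (hR : S.Rigid) (hQ : S.Quiet)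
    (s : Stage 1 TowerRates.wide S (Margins.routeG TowerRates.wide) k) {r : ℝ}
    (hc : S.ConfinedTo r) (hs : ∀ j, j ≤ k → S.ReadsIn j r (s.u (S.τ j)))
    {u : ℝ → EuclideanSpace ℝ (Fin 3) → EuclideanSpace ℝ (Fin 3)} {p : ℝ → EuclideanSpace ℝ (Fin 3) → ℝ}
    (hcl : IsClassicalNSSolutionOn (Icc 0 (S.τ (k + 1))) 1 S.f u p)
    (hagree : ∀ t ∈ Icc 0 (S.τ k), u t = s.u t ∧ p t = s.p t)
    (henergy : ∃ C : ℝ≥0∞, C < ⊤ ∧ ∀ t ∈ Icc 0 (S.τ (k + 1)), ∫⁻ x, ‖u t x‖ₑ ^ 2 ≤ C)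
    (hceil : ∀ t ∈ Icc 0 (S.τ (k + 1)), ∀ x, ‖u t x‖ ≤ S.c₂ * TowerRates.wide.Y (k + 1))
    (hno : ∀ (x : EuclideanSpace ℝ (Fin 3)) (γ : ℝ → EuclideanSpace ℝ (Fin 3)), ‖x‖ ≤ r →
      ContDiff ℝ 1 γ → γ 0 = γ 1 →
      (∀ σ ∈ Icc (0 : ℝ) 1, γ σ ∈ Metric.closedBall x (1 / TowerRates.wide.N (k + 1))) →
      (∀ σ ∈ Icc (0 : ℝ) 1, ‖deriv γ σ‖ ≤ 8 * π / TowerRates.wide.N (k + 1)) →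
      circulation (u (S.τ (k + 1))) γ < S.c₁ * TowerRates.wide.N (k + 1) ^ (TowerRates.wide.β - 2)) :
    ¬ CoreFloorAt k := fun h => by
  obtain ⟨x, γ, hx, hγ, hcl₀, hball, hspeed, hcirc⟩ :=
    h.core_mem_reball hP hR hQ s hc hs hcl hagree henergy hceil
  exact absurd (hno x γ hx hγ hcl₀ hball hspeed) (not_lt.2 hcirc)

/-- **All three floor stubs at once, re-balled** (= `ReadoutFloorsAt.readsIn_reball` through
`readoutFloorsAt_of_floors`): under `SpeedFloorAt k ∧ StrainFloorAt k ∧ CoreFloorAt k`, every tame continuation of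
every registered level-`k` stage reads level `k + 1` inside every admissible ball. [cite: Palasek2026ElementaryModel, §4] -/
theorem readsIn_reball_of_floors (h₁ : SpeedFloorAt k) (h₂ : StrainFloorAt k) (h₃ : CoreFloorAt k)
    (hP : S.Pins 8 (6 / 5)) (hR : S.Rigid) (hQ : S.Quiet)
    (s : Stage 1 TowerRates.wide S (Margins.routeG TowerRates.wide) k) {r : ℝ}
    (hc : S.ConfinedTo r) (hs : ∀ j, j ≤ k → S.ReadsIn j r (s.u (S.τ j)))
    {u : ℝ → EuclideanSpace ℝ (Fin 3) → EuclideanSpace ℝ (Fin 3)} {p : ℝ → EuclideanSpace ℝ (Fin 3) → ℝ}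
    (hcl : IsClassicalNSSolutionOn (Icc 0 (S.τ (k + 1))) 1 S.f u p)
    (hagree : ∀ t ∈ Icc 0 (S.τ k), u t = s.u t ∧ p t = s.p t)
    (henergy : ∃ C : ℝ≥0∞, C < ⊤ ∧ ∀ t ∈ Icc 0 (S.τ (k + 1)), ∫⁻ x, ‖u t x‖ₑ ^ 2 ≤ C)
    (hceil : ∀ t ∈ Icc 0 (S.τ (k + 1)), ∀ x, ‖u t x‖ ≤ S.c₂ * TowerRates.wide.Y (k + 1)) :
    S.ReadsIn (k + 1) r (u (S.τ (k + 1))) :=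
  (readoutFloorsAt_of_floors h₁ h₂ h₃).readsIn_reball hP hR hQ s hc hs hcl hagree henergy hceil

end Floors

/-! ## §3 (g4 append) The same for balls of ANY centre -/

section AnyCentre

open Schedule

variable {k : ℕ} {P : Schedule TowerRates.wide → (EuclideanSpace ℝ (Fin 3) → EuclideanSpace ℝ (Fin 3)) → Prop}
  {S : Schedule TowerRates.wide}

/-- **A readout property re-centred and re-balled.** If `ReadoutAt k P` holds, then for every pinned rigid quiet
wide schedule `S`, every registered level-`k` stage `s`, every ball `B̄(c, r)` (any centre, any radius) that confines
`(u₀, f)` and reads the levels `j ≤ k` of `s`, and every tame continuation `(u, p)` of `s` to `τ (k+1)`, the property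
holds for the RE-CENTRED slice with the re-centred re-balled schedule in the predicate slot:
`P ((S.translate c).reball r) (y ↦ u (τ (k+1)) (c + y))` (apply the hypothesis to `(S.translate c).reball r`,
`s.translate c r`, and the translated continuation — `IsClassicalNSSolutionOn.spaceTranslate`, energy by translation
invariance of Lebesgue measure). [cite: Palasek2026ElementaryModel, §4] -/
theorem ReadoutAt.translate_reball (h : ReadoutAt k P) (hP : S.Pins 8 (6 / 5)) (hR : S.Rigid) (hQ : S.Quiet)
    (s : Stage 1 TowerRates.wide S (Margins.routeG TowerRates.wide) k) {c : EuclideanSpace ℝ (Fin 3)} {r : ℝ}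
    (hc : (S.translate c).ConfinedTo r) (hs : ∀ j, j ≤ k → S.ReadsInBall j c r (s.u (S.τ j)))
    {u : ℝ → EuclideanSpace ℝ (Fin 3) → EuclideanSpace ℝ (Fin 3)} {p : ℝ → EuclideanSpace ℝ (Fin 3) → ℝ}
    (hcl : IsClassicalNSSolutionOn (Icc 0 (S.τ (k + 1))) 1 S.f u p)
    (hagree : ∀ t ∈ Icc 0 (S.τ k), u t = s.u t ∧ p t = s.p t)
    (henergy : ∃ C : ℝ≥0∞, C < ⊤ ∧ ∀ t ∈ Icc 0 (S.τ (k + 1)), ∫⁻ x, ‖u t x‖ₑ ^ 2 ≤ C)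
    (hceil : ∀ t ∈ Icc 0 (S.τ (k + 1)), ∀ x, ‖u t x‖ ≤ S.c₂ * TowerRates.wide.Y (k + 1)) :
    P ((S.translate c).reball r) (fun y => u (S.τ (k + 1)) (c + y)) := by
  have hcl' : IsClassicalNSSolutionOn (Icc 0 (((S.translate c).reball r).τ (k + 1))) 1
      ((S.translate c).reball r).f (fun t y => u t (c + y)) (fun t y => p t (c + y)) :=
    hcl.spaceTranslate c
  have hagree' : ∀ t ∈ Icc 0 (((S.translate c).reball r).τ k),
      (fun y => u t (c + y)) = (s.translate c r hs).u t ∧ (fun y => p t (c + y)) = (s.translate c r hs).p t := by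
    intro t ht
    obtain ⟨hu, hp⟩ := hagree t ht
    constructor
    · funext y; show u t (c + y) = s.u t (c + y); rw [hu]
    · funext y; show p t (c + y) = s.p t (c + y); rw [hp]
  have henergy' : ∃ C : ℝ≥0∞, C < ⊤ ∧ ∀ t ∈ Icc 0 (((S.translate c).reball r).τ (k + 1)),
      ∫⁻ y, ‖u t (c + y)‖ₑ ^ 2 ≤ C := by
    obtain ⟨C, hC, hb⟩ := henergy
    refine ⟨C, hC, fun t ht => ?_⟩
    rw [lintegral_add_left_eq_self (μ := volume) (fun x => ‖u t x‖ₑ ^ 2) c]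
    exact hb t ht
  have hceil' : ∀ t ∈ Icc 0 (((S.translate c).reball r).τ (k + 1)), ∀ y,
      ‖u t (c + y)‖ ≤ ((S.translate c).reball r).c₂ * TowerRates.wide.Y (k + 1) :=
    fun t ht y => hceil t ht (c + y)
  exact h ((S.translate c).reball r) (hP.translate_reball hc) ((hR.translate c).reball r)
    ((hQ.translate c).reball r) (s.translate c r hs) _ _ hcl' hagree' henergy' hceil'

/-- **The speed floor in every ball of any centre.** Under `SpeedFloorAt k`, every tame continuation of every
registered level-`k` stage shows speed `≥ c₁ Y_{k+1}` at `τ (k+1)` inside EVERY ball `B̄(c, r)` that confines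
`(u₀, f)` and reads the levels `j ≤ k` of the stage. [cite: Palasek2026ElementaryModel, §4] -/
theorem SpeedFloorAt.speed_mem_ball (h : SpeedFloorAt k) (hP : S.Pins 8 (6 / 5)) (hR : S.Rigid)
    (hQ : S.Quiet) (s : Stage 1 TowerRates.wide S (Margins.routeG TowerRates.wide) k)
    {c : EuclideanSpace ℝ (Fin 3)} {r : ℝ} (hc : (S.translate c).ConfinedTo r)
    (hs : ∀ j, j ≤ k → S.ReadsInBall j c r (s.u (S.τ j)))
    {u : ℝ → EuclideanSpace ℝ (Fin 3) → EuclideanSpace ℝ (Fin 3)} {p : ℝ → EuclideanSpace ℝ (Fin 3) → ℝ}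
    (hcl : IsClassicalNSSolutionOn (Icc 0 (S.τ (k + 1))) 1 S.f u p)
    (hagree : ∀ t ∈ Icc 0 (S.τ k), u t = s.u t ∧ p t = s.p t)
    (henergy : ∃ C : ℝ≥0∞, C < ⊤ ∧ ∀ t ∈ Icc 0 (S.τ (k + 1)), ∫⁻ x, ‖u t x‖ₑ ^ 2 ≤ C)
    (hceil : ∀ t ∈ Icc 0 (S.τ (k + 1)), ∀ x, ‖u t x‖ ≤ S.c₂ * TowerRates.wide.Y (k + 1)) :
    ∃ x, ‖x - c‖ ≤ r ∧ S.c₁ * TowerRates.wide.Y (k + 1) ≤ ‖u (S.τ (k + 1)) x‖ := by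
  obtain ⟨y, hy, hv⟩ := ReadoutAt.translate_reball h hP hR hQ s hc hs hcl hagree henergy hceil
  exact ⟨c + y, by rwa [add_sub_cancel_left], hv⟩

/-- **TEMPLATE for `SpeedFloorAt k`, any centre** (at `k = 1`: the registered stub `stub_speed_floor_at_one`): ONE
registered level-`k` stage, ONE ball `B̄(c, r)` confining `(u₀, f)` and reading its levels `j ≤ k`, ONE tame
continuation whose speed at `τ (k+1)` stays `< c₁ Y_{k+1}` throughout `B̄(c, r)` — refutes `SpeedFloorAt k`.
(Vacuity warning: no registered stage is known.) [cite: Palasek2026ElementaryModel, §4] -/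
theorem not_speedFloorAt_of_continuation_speed_lt_ball (hP : S.Pins 8 (6 / 5)) (hR : S.Rigid) (hQ : S.Quiet)
    (s : Stage 1 TowerRates.wide S (Margins.routeG TowerRates.wide) k) {c : EuclideanSpace ℝ (Fin 3)} {r : ℝ}
    (hc : (S.translate c).ConfinedTo r) (hs : ∀ j, j ≤ k → S.ReadsInBall j c r (s.u (S.τ j)))
    {u : ℝ → EuclideanSpace ℝ (Fin 3) → EuclideanSpace ℝ (Fin 3)} {p : ℝ → EuclideanSpace ℝ (Fin 3) → ℝ}
    (hcl : IsClassicalNSSolutionOn (Icc 0 (S.τ (k + 1))) 1 S.f u p)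
    (hagree : ∀ t ∈ Icc 0 (S.τ k), u t = s.u t ∧ p t = s.p t)
    (henergy : ∃ C : ℝ≥0∞, C < ⊤ ∧ ∀ t ∈ Icc 0 (S.τ (k + 1)), ∫⁻ x, ‖u t x‖ₑ ^ 2 ≤ C)
    (hceil : ∀ t ∈ Icc 0 (S.τ (k + 1)), ∀ x, ‖u t x‖ ≤ S.c₂ * TowerRates.wide.Y (k + 1))
    (hesc : ∀ x, ‖x - c‖ ≤ r → ‖u (S.τ (k + 1)) x‖ < S.c₁ * TowerRates.wide.Y (k + 1)) :
    ¬ SpeedFloorAt k := fun h => by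
  obtain ⟨x, hx, hge⟩ := h.speed_mem_ball hP hR hQ s hc hs hcl hagree henergy hceil
  exact absurd (hesc x hx) (not_lt.2 hge)

/-- **The strain floor in every ball of any centre.** Under `StrainFloorAt k`, every tame continuation of every
registered level-`k` stage shows a velocity gradient of operator norm `≥ c₁ A_{k+1}` at `τ (k+1)` inside EVERY ball
`B̄(c, r)` that confines `(u₀, f)` and reads the levels `j ≤ k` of the stage (`fderiv_comp_add_left`).
[cite: Palasek2026ElementaryModel, §4] -/
theorem StrainFloorAt.strain_mem_ball (h : StrainFloorAt k) (hP : S.Pins 8 (6 / 5)) (hR : S.Rigid)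
    (hQ : S.Quiet) (s : Stage 1 TowerRates.wide S (Margins.routeG TowerRates.wide) k)
    {c : EuclideanSpace ℝ (Fin 3)} {r : ℝ} (hc : (S.translate c).ConfinedTo r)
    (hs : ∀ j, j ≤ k → S.ReadsInBall j c r (s.u (S.τ j)))
    {u : ℝ → EuclideanSpace ℝ (Fin 3) → EuclideanSpace ℝ (Fin 3)} {p : ℝ → EuclideanSpace ℝ (Fin 3) → ℝ}
    (hcl : IsClassicalNSSolutionOn (Icc 0 (S.τ (k + 1))) 1 S.f u p)
    (hagree : ∀ t ∈ Icc 0 (S.τ k), u t = s.u t ∧ p t = s.p t)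
    (henergy : ∃ C : ℝ≥0∞, C < ⊤ ∧ ∀ t ∈ Icc 0 (S.τ (k + 1)), ∫⁻ x, ‖u t x‖ₑ ^ 2 ≤ C)
    (hceil : ∀ t ∈ Icc 0 (S.τ (k + 1)), ∀ x, ‖u t x‖ ≤ S.c₂ * TowerRates.wide.Y (k + 1)) :
    ∃ x, ‖x - c‖ ≤ r ∧ S.c₁ * TowerRates.wide.A (k + 1) ≤ ‖fderiv ℝ (u (S.τ (k + 1))) x‖ := by
  obtain ⟨y, hy, hw⟩ := ReadoutAt.translate_reball h hP hR hQ s hc hs hcl hagree henergy hceil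
  refine ⟨c + y, by rwa [add_sub_cancel_left], ?_⟩
  have e : fderiv ℝ (fun y => u (S.τ (k + 1)) (c + y)) y = fderiv ℝ (u (S.τ (k + 1))) (c + y) :=
    fderiv_comp_add_left c
  rw [← e]
  exact hw

/-- **TEMPLATE for `StrainFloorAt k`, any centre** (at `k = 1`: `stub_strain_floor_at_one`): ONE registered level-`k`
stage, ONE admissible ball `B̄(c, r)`, ONE tame continuation whose velocity gradient at `τ (k+1)` has operator norm
`< c₁ A_{k+1}` throughout `B̄(c, r)` — refutes `StrainFloorAt k`. [cite: Palasek2026ElementaryModel, §4] -/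
theorem not_strainFloorAt_of_continuation_strain_lt_ball (hP : S.Pins 8 (6 / 5)) (hR : S.Rigid) (hQ : S.Quiet)
    (s : Stage 1 TowerRates.wide S (Margins.routeG TowerRates.wide) k) {c : EuclideanSpace ℝ (Fin 3)} {r : ℝ}
    (hc : (S.translate c).ConfinedTo r) (hs : ∀ j, j ≤ k → S.ReadsInBall j c r (s.u (S.τ j)))
    {u : ℝ → EuclideanSpace ℝ (Fin 3) → EuclideanSpace ℝ (Fin 3)} {p : ℝ → EuclideanSpace ℝ (Fin 3) → ℝ}
    (hcl : IsClassicalNSSolutionOn (Icc 0 (S.τ (k + 1))) 1 S.f u p)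
    (hagree : ∀ t ∈ Icc 0 (S.τ k), u t = s.u t ∧ p t = s.p t)
    (henergy : ∃ C : ℝ≥0∞, C < ⊤ ∧ ∀ t ∈ Icc 0 (S.τ (k + 1)), ∫⁻ x, ‖u t x‖ₑ ^ 2 ≤ C)
    (hceil : ∀ t ∈ Icc 0 (S.τ (k + 1)), ∀ x, ‖u t x‖ ≤ S.c₂ * TowerRates.wide.Y (k + 1))
    (hesc : ∀ x, ‖x - c‖ ≤ r → ‖fderiv ℝ (u (S.τ (k + 1))) x‖ < S.c₁ * TowerRates.wide.A (k + 1)) :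
    ¬ StrainFloorAt k := fun h => by
  obtain ⟨x, hx, hge⟩ := h.strain_mem_ball hP hR hQ s hc hs hcl hagree henergy hceil
  exact absurd (hesc x hx) (not_lt.2 hge)

/-- **The lower half in every ball of any centre.** Under `ReadoutFloorsAt k`, every tame continuation of every
registered level-`k` stage reads level `k + 1` (speed, strain AND core) inside EVERY ball `B̄(c, r)` that confines
`(u₀, f)` and reads the levels `j ≤ k` of the stage (`readsIn_translate_iff` turns the re-centred reading into the
ball reading). [cite: Palasek2026ElementaryModel, §4] -/
theorem ReadoutFloorsAt.readsInBall (h : ReadoutFloorsAt k) (hP : S.Pins 8 (6 / 5)) (hR : S.Rigid)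
    (hQ : S.Quiet) (s : Stage 1 TowerRates.wide S (Margins.routeG TowerRates.wide) k)
    {c : EuclideanSpace ℝ (Fin 3)} {r : ℝ} (hc : (S.translate c).ConfinedTo r)
    (hs : ∀ j, j ≤ k → S.ReadsInBall j c r (s.u (S.τ j)))
    {u : ℝ → EuclideanSpace ℝ (Fin 3) → EuclideanSpace ℝ (Fin 3)} {p : ℝ → EuclideanSpace ℝ (Fin 3) → ℝ}
    (hcl : IsClassicalNSSolutionOn (Icc 0 (S.τ (k + 1))) 1 S.f u p)
    (hagree : ∀ t ∈ Icc 0 (S.τ k), u t = s.u t ∧ p t = s.p t)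
    (henergy : ∃ C : ℝ≥0∞, C < ⊤ ∧ ∀ t ∈ Icc 0 (S.τ (k + 1)), ∫⁻ x, ‖u t x‖ₑ ^ 2 ≤ C)
    (hceil : ∀ t ∈ Icc 0 (S.τ (k + 1)), ∀ x, ‖u t x‖ ≤ S.c₂ * TowerRates.wide.Y (k + 1)) :
    S.ReadsInBall (k + 1) c r (u (S.τ (k + 1))) := by
  have hread : S.ReadsIn (k + 1) r (fun y => u (S.τ (k + 1)) (c + y)) :=
    ReadoutAt.translate_reball (readoutFloorsAt_iff_readoutAt_letter.1 h) hP hR hQ s hc hs hcl hagree henergy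
      hceil
  exact readsIn_translate_iff.1 hread

/-- **All three floor stubs at once, any centre.** [cite: Palasek2026ElementaryModel, §4] -/
theorem readsInBall_of_floors (h₁ : SpeedFloorAt k) (h₂ : StrainFloorAt k) (h₃ : CoreFloorAt k)
    (hP : S.Pins 8 (6 / 5)) (hR : S.Rigid) (hQ : S.Quiet)
    (s : Stage 1 TowerRates.wide S (Margins.routeG TowerRates.wide) k) {c : EuclideanSpace ℝ (Fin 3)} {r : ℝ}
    (hc : (S.translate c).ConfinedTo r) (hs : ∀ j, j ≤ k → S.ReadsInBall j c r (s.u (S.τ j)))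
    {u : ℝ → EuclideanSpace ℝ (Fin 3) → EuclideanSpace ℝ (Fin 3)} {p : ℝ → EuclideanSpace ℝ (Fin 3) → ℝ}
    (hcl : IsClassicalNSSolutionOn (Icc 0 (S.τ (k + 1))) 1 S.f u p)
    (hagree : ∀ t ∈ Icc 0 (S.τ k), u t = s.u t ∧ p t = s.p t)
    (henergy : ∃ C : ℝ≥0∞, C < ⊤ ∧ ∀ t ∈ Icc 0 (S.τ (k + 1)), ∫⁻ x, ‖u t x‖ₑ ^ 2 ≤ C)
    (hceil : ∀ t ∈ Icc 0 (S.τ (k + 1)), ∀ x, ‖u t x‖ ≤ S.c₂ * TowerRates.wide.Y (k + 1)) :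
    S.ReadsInBall (k + 1) c r (u (S.τ (k + 1))) :=
  (readoutFloorsAt_of_floors h₁ h₂ h₃).readsInBall hP hR hQ s hc hs hcl hagree henergy hceil

end AnyCentre

end Summit.NavierStokesRegularity.FluidComputer.PalasekTowerClayBridge

end
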